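import Summits.BirchSwinnertonDyer.BirchSwinnertonDyer.Theorems.GenusKolyvaginAtTwoGenusPrimitiveSupplyAtTwoPosDiscShallowKFourPosSelmerCountCurrency
import Summits.BirchSwinnertonDyer.BirchSwinnertonDyer.Theorems.GenusKolyvaginAtTwoShaRatCardOfKFour
import Literature.NumberTheory.EllipticCurves.ZpCorankLevelProfile
import Literature.GroupTheory.FiniteAbelian.HomCyclicGroups
import HarnessLib

/-!
# Route `GenusKolyvaginAtTwo`, cruxes K₄⁺ `K4Pos` (stmt-BirchSwinnertonDyer-31469) / K₄ `K4Neg` (31526) — THE SELMER PROFILE OF THE CUT CELLS: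
# `#Sel_(2^k)(E/ℚ) = 4^(min k e)` for EVERY `k`, with `4^e = #Ш(E/ℚ)[2^∞]`, `1 ≤ e ≤ M₀` (mod Q2 ONLY); K₄⁺ ⟺ `#Sel_(2^M₀)(E/ℚ) = 4^(M₀)` GZK-free

Width seat `bsd-line-gk2-p5` g37 (cell `bsd-f1-sign2`), `--supports stmt-BirchSwinnertonDyer-31469 --as helper`; sequel of this seat's
`…KFourPosSelmerCountCurrency` (p774671, §1: `#Sel_(2^m)(E/F) = #Ш(E/F)[2^m]` when `rank E(F) = 0`, `E(F)[2] = 0`) over gk2-p4 g29's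
`…ShaRatCardOfKFour` (mod Q2, NO GZK: `ShaCores.mordellWeilRank_eq_zero_and_finite_shaPrimary_rat_of_cut`; the one-block structures
`exists_addEquiv_shaPrimary_of_kFourPos_cut` / `…_of_kFourNeg_cut`: `Ш(E/ℚ)[2^∞] ≃ (ℤ/2^e)²`, `1 ≤ e ≤ M₀`; ★★ `kFourPos_witness_iff_natCard_shaPrimary_rat_eq_pow`).
THEOREMS ONLY (no definition, no named fact, no `sorry`); standard axioms.  **BSD is NOT proved by this file; K4Pos / K4Neg are NOT proved; nothing is closed.**

* §1 counting in `ℤ/2^e`: `natCard_torsionBy_zmod_two_pow` (`#(ℤ/2^e)[2^k] = 2^(min k e)`, gcd step = tree `SigmaEta.two_pow_gcd_two_pow`, inlined), `natCard_torsionBy_zmod_sq_two_pow` (`= 4^(min k e)` for the square).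
* §2 `natCard_selmerGroup_two_pow_eq_pow_min_of_addEquiv` — ANY number field: `rank E(F) = 0`, `E(F)[2] = 0`, `Ш(E/F)[2^∞] ≃ (ℤ/2^e)²` ⟹
  **`#Sel_(2^k)(E/F) = 4^(min k e)` for every `k`**.
* §3 THE K₄⁺ CUT CELL (gk2-p4's frame VERBATIM, mod Q2 only): `exists_selmerProfile_of_kFourPos_cut` — **∃ e, `1 ≤ e ≤ M₀`, `#Ш(E/ℚ)[2^∞] = 4^e`, and
  `#Sel_(2^k)(E/ℚ) = 4^(min k e)` for EVERY `k`**; ★★′ `kFourPos_witness_iff_natCard_selmerGroup_eq_pow_of_cut` — **K4Pos witness ⟺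
  `#Sel_(2^M₀)(E/ℚ) = 4^(M₀)`** WITHOUT GZK; `kFourPos_witness_iff_natCard_selmerGroup_ne_of_cut` — **⟺ `#Sel_(2^M₀)(E/ℚ) ≠ #Sel_(2^(M₀−1))(E/ℚ)`**;
  depth two: `natCard_selmerGroup_four_eq_four_or_sixteen_of_kFourPos_cut` — **`#Sel₄(E/ℚ) ∈ {4, 16}` on the cell, unconditionally (mod Q2)** — and
  `kFourPos_witness_iff_natCard_selmerGroup_four_eq_sixteen_of_cut` — **K4Pos ⟺ `#Sel₄(E/ℚ) = 16`** at `M₀ = 2`.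
* §4 the K₄ cut cell (Δ<0): `exists_selmerProfile_of_kFourNeg_cut` — the same profile over `exists_addEquiv_shaPrimary_of_kFourNeg_cut`.
INSTRUMENT (for `-data` / the pen): on a K₄/K₄⁺ census cell a `2^k`-descent over `ℚ` returns `4^(min k e)`; the sequence `4, 16, …` climbs until
`k = e` and then stops; K₄ says it stops exactly at `k = M₀` (BSD: `#Ш_an = 4^(M₀)`).  One `2^(M₀)`-descent decides K₄ at that curve; a `4`-descent
returning `4` on a cell with `M₀ ≥ 2` refutes K₄ (and BSD) there.  Class-wide = the `2`-part of BSD in rank `0` given the Gross–Zagier index: OPEN.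
BSD is NOT proved by any of this.

References: [SilvermanAEC2009] Thm. X.4.2, X.4.14; [Kolyvagin1989Izv] Thm. B₂; [McCallumLMS1991] §5 Thm. 5.4, Cor. 5.6; [Cassels1962ArithmeticIV] §1;
[Fuchs1970] Ch. I §1, §8; [Hungerford1974] Ch. II Lemma 2.5, Ch. IV §4 Ex. 1.
-/

set_option autoImplicit false
-- the Theorems namespace of this sub repeats the summit name by design (D-0017 nested layout)
set_option linter.dupNamespace false

noncomputable section

open scoped Classical
open scoped AddSubgroup

namespace Summit.BirchSwinnertonDyer.BirchSwinnertonDyer.Theorems.GenusExact.PlusDescent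

open WeierstrassCurve NumberField IsDedekindDomain Field Literature.NumberTheory.EllipticCurves
  Literature.NumberTheory.GaloisRepresentations Literature.NumberTheory.EllipticCurves.ModularForms AddSubgroup
  Literature.NumberTheory.EllipticCurves.RingClassField
open Summit.BirchSwinnertonDyer.BirchSwinnertonDyer.Theses.GenusKolyvaginAtTwo (KolyvaginRelationAtTwo)
open Summit.BirchSwinnertonDyer.BirchSwinnertonDyer.Theorems.GenusExact.ShaCores
  (mordellWeilRank_eq_zero_and_finite_shaPrimary_rat_of_cut exists_addEquiv_shaPrimary_of_kFourPos_cut exists_addEquiv_shaPrimary_of_kFourNeg_cut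
    kFourPos_witness_iff_natCard_shaPrimary_rat_eq_pow)
open Literature.GroupTheory.FiniteAbelian (natCard_addMonoidHom_zmod natCard_addMonoidHom_zmod_zmod)

/-! ## §1 Counting in `ℤ/2^e`: `#(ℤ/2^e)[2^k] = 2^(min k e)` -/

/-- **`#(ℤ/2^e)[2^k] = 2^(min k e)`** (`(ℤ/n)[m] ≅ Hom(ℤ/m, ℤ/n)` has `gcd(m, n)` elements — Hungerford IV §4 Ex. 1, tree
`natCard_addMonoidHom_zmod{,_zmod}`). [cite: Hungerford1974, Ch. IV §4 Exercise 1 (a), (b)] -/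
theorem natCard_torsionBy_zmod_two_pow (e k : ℕ) : Nat.card ((ZMod (2 ^ e))[((2 ^ k : ℕ) : ℤ)]) = 2 ^ min k e := by
  haveI : NeZero (2 ^ e) := ⟨pow_ne_zero e two_ne_zero⟩
  -- `gcd(2^k, 2^e) = 2^(min k e)` (tree: `Rank1Residual.ManinAdditive.SigmaEta.two_pow_gcd_two_pow`; inlined to keep the import cone small)
  have hgcd : Nat.gcd (2 ^ k) (2 ^ e) = 2 ^ min k e := by
    rcases le_total k e with h | h
    · rw [Nat.gcd_eq_left (Nat.pow_dvd_pow 2 h), min_eq_left h]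
    · rw [Nat.gcd_eq_right (Nat.pow_dvd_pow 2 h), min_eq_right h]
  rw [← natCard_addMonoidHom_zmod (ZMod (2 ^ e)) (2 ^ k), natCard_addMonoidHom_zmod_zmod, hgcd]

/-- **`#(ℤ/2^e × ℤ/2^e)[2^k] = 4^(min k e)`.** [cite: Hungerford1974, Ch. IV §4 Exercise 1] [cite: Fuchs1970, Ch. I §8] -/
theorem natCard_torsionBy_zmod_sq_two_pow (e k : ℕ) : Nat.card ((ZMod (2 ^ e) × ZMod (2 ^ e))[((2 ^ k : ℕ) : ℤ)]) = 4 ^ min k e := by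
  rw [natCard_torsionBy_prod, natCard_torsionBy_zmod_two_pow, ← pow_two, ← pow_mul, mul_comm, pow_mul]
  norm_num

/-! ## §2 `#Sel_(2^k)(E/F) = 4^(min k e)` from `rank 0`, `E(F)[2] = 0`, `Ш(E/F)[2^∞] ≃ (ℤ/2^e)²` (any number field) -/

section Descent

variable {F : Type} [Field F] [NumberField F] (V : WeierstrassCurve F) [V.IsElliptic]

/-- **THE SELMER PROFILE OF A ONE-BLOCK CURVE**: an elliptic curve over a number field with `rank E(F) = 0`, `E(F)[2] = 0` and
`Ш(E/F)[2^∞] ≃ ℤ/2^e × ℤ/2^e` has **`#Sel_(2^k)(E/F) = 4^(min k e)` for every `k`**: `#Sel_(2^k) = #Ш[2^k]` (prequel §1, AEC X.4.2) `= #(Ш[2^∞])[2^k]`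
`= #(ℤ/2^e × ℤ/2^e)[2^k]` (§1). [cite: SilvermanAEC2009, Thm. X.4.2 (a), (b)] [cite: Fuchs1970, Ch. I §1, §8] -/
theorem natCard_selmerGroup_two_pow_eq_pow_min_of_addEquiv (hrk : V.mordellWeilRank = 0)
    (h2 : ∀ P : V.toAffine.Point, (2 : ℤ) • P = 0 → P = 0) {e : ℕ}
    (eY : AddCommGroup.primaryComponent (↥V.sha) 2 ≃+ ZMod (2 ^ e) × ZMod (2 ^ e)) (k : ℕ) :
    Nat.card (selmerGroup V ((2 ^ k : ℕ) : ℤ)) = 4 ^ min k e := by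
  haveI : Fact (Nat.Prime 2) := ⟨Nat.prime_two⟩
  rw [natCard_selmerGroup_two_pow_eq_natCard_shaTorsionBy V hrk h2 k,
    GenusExact.CasselsTateNumberField.natCard_sha_torsionBy_pow_eq_primaryComponent V 2 k, natCard_torsionBy_congr_natCast eY (2 ^ k),
    natCard_torsionBy_zmod_sq_two_pow]

end Descent

/-! ## §3 The K₄⁺ cut cell: the Selmer profile, ★★′ GZK-free, depth two -/

section KFourPos

variable (W : WeierstrassCurve ℚ) [W.IsElliptic] [W.IsGloballyMinimal] [NeZero (W.conductorNorm ℤ)]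
variable (K : Type) [Field K] [NumberField K]

/-- **THE SELMER PROFILE OF THE K₄⁺ CUT CELL, mod Q2 (no GZK, no witness).**  On gk2-p4 g29's K₄⁺ cut frame VERBATIM (globally minimal non-CM
`E/ℚ`, odd Tamagawa product, an odd multiplicative prime `v`, `Δ > 0`; `K` imaginary quadratic, `d_K` odd `≠ −3`, Heegner, the two B₂ non-squares,
`ρ_{E,2^n}` onto; a datum with `P(1)` of infinite order and `2^(M₀) ∥ P(1)`; a shallow twin `Wd = Cd • E^(d_K)`, `#Sel₂(Wd) = 2`, `ord₂ C(Wd) = 0`;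
the K₄⁺ clause `#Sel₂(E) = 4 ∧ ∃ c, loc_∞ c ≠ 0`; `r_an(E) = 0`; `2` split; `σ₀ ≠ 1`): **there is ONE `e` with `1 ≤ e ≤ M₀`, `#Ш(E/ℚ)[2^∞] = 4^e` and
`#Sel_(2^k)(E/ℚ) = 4^(min k e)` for EVERY `k`.**  (`e ≤ M₀` is Kolyvagin's B₂; K4Pos at `E` ⟺ `e = M₀`, ★★′ below.)  BSD is NOT proved by this.
[cite: Kolyvagin1989Izv, Thm. B₂] [cite: SilvermanAEC2009, Thm. X.4.2, X.4.14] [cite: Cassels1962ArithmeticIV, §1] [cite: McCallumLMS1991, §5 Cor. 5.6] -/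
theorem exists_selmerProfile_of_kFourPos_cut (hQ2 : KolyvaginRelationAtTwo) (hcm : ¬ W.HasCM)
    (hT : Odd W.tamagawaProduct) (v : HeightOneSpectrum (𝓞 ℚ)) (h2v : ((2 : ℕ) : 𝓞 ℚ) ∉ v.asIdeal)
    (hNv : ((W.conductorNorm ℤ : ℕ) : 𝓞 ℚ) ∈ v.asIdeal) (hmult : W.HasMultiplicativeReductionAt v) (hpos : 0 < W.Δ)
    (hIQ : IsImaginaryQuadratic K) (hodd : Odd (NumberField.discr K))
    (h3 : NumberField.discr K ≠ -3) (hHe : SatisfiesHeegnerHypothesis (W.conductorNorm ℤ) K)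
    (hsq1 : ¬ IsSquare ((NumberField.discr K : ℚ) * -|W.Δ|)) (hsq2 : ¬ IsSquare ((NumberField.discr K : ℚ) * (-(2 * |W.Δ|))))
    (hρ : ∀ n : ℕ, 0 < n → W.HasSurjectiveModNGaloisRep ((2 : ℤ) ^ n))
    (Dt : ModularParametrizationData W (W.conductorNorm ℤ)) (β : ℤ) (ι : K →+* ℂ) (d₁ : KolyvaginHeegnerData Dt β ι 1)
    (hy : ¬ IsOfFinAddOrder d₁.derivedPoint) (M₀ : ℕ)
    (hdiv : ∃ Q : (W.baseChange (ringClassField K ι 1)).toAffine.Point, ((2 ^ M₀ : ℕ) : ℤ) • Q = d₁.derivedPoint)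
    (hndiv : ¬ ∃ Q : (W.baseChange (ringClassField K ι 1)).toAffine.Point, ((2 ^ (M₀ + 1) : ℕ) : ℤ) • Q = d₁.derivedPoint)
    (Wd : WeierstrassCurve ℚ) [Wd.IsElliptic] (Cd : VariableChange ℚ) (hCd : Cd • W.quadraticTwist (discr K : ℚ) = Wd)
    (hSel : Nat.card (Wd.selmerGroup 2) = 2) (hDEF : padicValNat 2 Wd.tamagawaProduct = 0)
    (h4 : Nat.card (W.selmerGroup 2) = 4 ∧ ∃ c ∈ (W.kummerSelmerStructure ((2 : ℕ) : ℤ)).selmerGroup,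
      galoisCohomology.localization (W.torsionGaloisModule ((2 : ℕ) : ℤ)) (Sum.inl Rat.infinitePlace) 1 c ≠ 0)
    (hr0 : W.analyticRank = 0) (h2K : ((Ideal.span {(2 : ℤ)}).primesOver (𝓞 K)).ncard = 2) {σ₀ : K ≃ₐ[ℚ] K} (hσ₀ : σ₀ ≠ 1) :
    ∃ e : ℕ, 1 ≤ e ∧ e ≤ M₀ ∧ Nat.card (AddCommGroup.primaryComponent (↥W.sha) 2) = 4 ^ e ∧
      ∀ k : ℕ, Nat.card (W.selmerGroup ((2 ^ k : ℕ) : ℤ)) = 4 ^ min k e := by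
  have hw : W.rootNumber = 1 :=
    (Literature.Barriers.BirchSwinnertonDyer.even_analyticRank_iff_of_isNewformOf_conductorLevel Dt.isNewformOf).mp
      (by rw [hr0]; exact Even.zero)
  have hs2 : W.HasSurjectiveModNGaloisRep 2 := by simpa using hρ 1 one_pos
  obtain ⟨hrk0, -⟩ := mordellWeilRank_eq_zero_and_finite_shaPrimary_rat_of_cut W K hQ2 hcm hT v h2v hNv hmult hIQ hodd h3 hHe hsq1 hsq2 hρ Dt β
    ι d₁ M₀ hndiv hw
  -- `E(ℚ)[2] = 0` (`convert` bridges the decidable-equality instance on `E(ℚ)` used by the general-`F` lemmas)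
  have h2t := forall_eq_zero_of_two_zsmul_eq_zero_of_natCard_torsionBy_two_eq_one W
    (by convert natCard_torsionBy_point_two_eq_one_of_hasSurjectiveModNGaloisRep_two W hs2)
  obtain ⟨e, he1, heM, -, ⟨eY⟩, -, hYe⟩ := exists_addEquiv_shaPrimary_of_kFourPos_cut W K hQ2 hcm hT v h2v hNv hmult hpos hIQ hodd h3 hHe hsq1
    hsq2 hρ Dt β ι d₁ hy M₀ hdiv hndiv Wd Cd hCd hSel hDEF h4 hr0 h2K hσ₀
  exact ⟨e, he1, heM, hYe, fun k ↦ natCard_selmerGroup_two_pow_eq_pow_min_of_addEquiv W hrk0 h2t eY k⟩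

/-- ★★′ **K4Pos witness ⟺ `#Sel_(2^M₀)(E/ℚ) = 4^(M₀)` — mod Q2 ONLY (no GZK)**, on gk2-p4 g29's K₄⁺ cut frame VERBATIM with `M₀ ≥ 1`: their
★★ `kFourPos_witness_iff_natCard_shaPrimary_rat_eq_pow` (witness ⟺ `#Ш(E/ℚ)[2^∞] = 4^(M₀)`) read through the profile (`#Ш(E/ℚ)[2^∞] = 4^e`,
`#Sel_(2^M₀)(E/ℚ) = 4^(min M₀ e)`, `e ≤ M₀`).  Supersedes the `hGZK` binder of this seat's `kFourPos_shape_iff_natCard_selmerGroup_eq_pow` (p774760).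
BSD / K4Pos are NOT proved by this. [cite: Kolyvagin1989Izv, Thm. B₂] [cite: McCallumLMS1991, §5 Thm. 5.4, Cor. 5.6] [cite: SilvermanAEC2009, Thm. X.4.2] -/
theorem kFourPos_witness_iff_natCard_selmerGroup_eq_pow_of_cut (hQ2 : KolyvaginRelationAtTwo) (hcm : ¬ W.HasCM)
    (hT : Odd W.tamagawaProduct) (v : HeightOneSpectrum (𝓞 ℚ)) (h2v : ((2 : ℕ) : 𝓞 ℚ) ∉ v.asIdeal)
    (hNv : ((W.conductorNorm ℤ : ℕ) : 𝓞 ℚ) ∈ v.asIdeal) (hmult : W.HasMultiplicativeReductionAt v) (hpos : 0 < W.Δ)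
    (hIQ : IsImaginaryQuadratic K) (hodd : Odd (NumberField.discr K))
    (h3 : NumberField.discr K ≠ -3) (hHe : SatisfiesHeegnerHypothesis (W.conductorNorm ℤ) K)
    (hsq1 : ¬ IsSquare ((NumberField.discr K : ℚ) * -|W.Δ|)) (hsq2 : ¬ IsSquare ((NumberField.discr K : ℚ) * (-(2 * |W.Δ|))))
    (hρ : ∀ n : ℕ, 0 < n → W.HasSurjectiveModNGaloisRep ((2 : ℤ) ^ n))
    (Dt : ModularParametrizationData W (W.conductorNorm ℤ)) (β : ℤ) (ι : K →+* ℂ) (d₁ : KolyvaginHeegnerData Dt β ι 1)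
    (hy : ¬ IsOfFinAddOrder d₁.derivedPoint) (M₀ : ℕ) (hM₀ : 1 ≤ M₀)
    (hdiv : ∃ Q : (W.baseChange (ringClassField K ι 1)).toAffine.Point, ((2 ^ M₀ : ℕ) : ℤ) • Q = d₁.derivedPoint)
    (hndiv : ¬ ∃ Q : (W.baseChange (ringClassField K ι 1)).toAffine.Point, ((2 ^ (M₀ + 1) : ℕ) : ℤ) • Q = d₁.derivedPoint)
    (Wd : WeierstrassCurve ℚ) [Wd.IsElliptic] [Wd.IsGloballyMinimal] (Cd : VariableChange ℚ) (hCd : Cd • W.quadraticTwist (discr K : ℚ) = Wd)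
    (hSel : Nat.card (Wd.selmerGroup 2) = 2) (hDEF : padicValNat 2 Wd.tamagawaProduct = 0)
    (h4 : Nat.card (W.selmerGroup 2) = 4 ∧ ∃ c ∈ (W.kummerSelmerStructure ((2 : ℕ) : ℤ)).selmerGroup,
      galoisCohomology.localization (W.torsionGaloisModule ((2 : ℕ) : ℤ)) (Sum.inl Rat.infinitePlace) 1 c ≠ 0)
    (hr0 : W.analyticRank = 0) (h2K : ((Ideal.span {(2 : ℤ)}).primesOver (𝓞 K)).ncard = 2) {σ₀ : K ≃ₐ[ℚ] K} (hσ₀ : σ₀ ≠ 1) :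
    (∃ (n : ℕ) (d : KolyvaginHeegnerData Dt β ι n), Squarefree n ∧
      (∀ ℓ ∈ n.primeFactors, Zhang2014.IsKolyvaginPrime (W.conductorNorm ℤ) W K 2 ℓ ∧ 2 ≤ Zhang2014.kolyvaginIndex W 2 ℓ ∧
        ∃ (v : HeightOneSpectrum (𝓞 ℚ)) (𝔓 : Ideal (absIntegers (𝓞 ℚ) ℚ)) (h : absoluteGaloisGroup ℚ),
          ((ℓ : ℕ) : 𝓞 ℚ) ∈ v.asIdeal ∧ 𝔓 ∈ v.primesAbove ∧ IsArithFrobAt (𝓞 ℚ) h 𝔓 ∧ ∃ u : W.geomTorsion ((2 : ℕ) : ℤ), h • u ≠ u) ∧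
      ¬ ∃ Q : (W.baseChange (ringClassField K ι n)).toAffine.Point, (2 : ℤ) • Q = d.derivedPoint) ↔
    Nat.card (W.selmerGroup ((2 ^ M₀ : ℕ) : ℤ)) = 4 ^ M₀ := by
  obtain ⟨e, -, heM, hYe, hprof⟩ := exists_selmerProfile_of_kFourPos_cut W K hQ2 hcm hT v h2v hNv hmult hpos hIQ hodd h3 hHe hsq1 hsq2 hρ Dt β ι
    d₁ hy M₀ hdiv hndiv Wd Cd hCd hSel hDEF h4 hr0 h2K hσ₀
  rw [kFourPos_witness_iff_natCard_shaPrimary_rat_eq_pow W K hQ2 hcm hT v h2v hNv hmult hpos hIQ hodd h3 hHe hsq1 hsq2 hρ Dt β ι d₁ hy M₀ hM₀ hdiv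
    hndiv Wd Cd hCd hSel hDEF h4 hr0 h2K hσ₀, hYe, hprof M₀]
  -- `4^e = 4^M₀ ↔ 4^(min M₀ e) = 4^M₀`, both `↔ e = M₀` given `e ≤ M₀`
  constructor
  · intro h
    have : e = M₀ := Nat.pow_right_injective (by norm_num : 2 ≤ 4) h
    rw [this, min_self]
  · intro h
    have hmin : min M₀ e = M₀ := Nat.pow_right_injective (by norm_num : 2 ≤ 4) h
    have : e = M₀ := le_antisymm heM (by rw [← hmin]; exact min_le_right _ _)
    rw [this]

/-- **K4Pos witness ⟺ `#Sel_(2^M₀)(E/ℚ) ≠ #Sel_(2^(M₀−1))(E/ℚ)` — mod Q2 ONLY**, on the same frame (`M₀ ≥ 1`): by the profile the two counts are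
`4^(min M₀ e)` and `4^(min (M₀−1) e)`, different iff `e ≥ M₀` iff `e = M₀`.  GZK-free form of this seat's ★ `kFourPos_shape_iff_natCard_selmerGroup_ne`
(p774671).  BSD / K4Pos are NOT proved by this. [cite: Kolyvagin1989Izv, Thm. B₂] [cite: McCallumLMS1991, §5 Thm. 5.4] [cite: SilvermanAEC2009, Thm. X.4.2] -/
theorem kFourPos_witness_iff_natCard_selmerGroup_ne_of_cut (hQ2 : KolyvaginRelationAtTwo) (hcm : ¬ W.HasCM)
    (hT : Odd W.tamagawaProduct) (v : HeightOneSpectrum (𝓞 ℚ)) (h2v : ((2 : ℕ) : 𝓞 ℚ) ∉ v.asIdeal)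
    (hNv : ((W.conductorNorm ℤ : ℕ) : 𝓞 ℚ) ∈ v.asIdeal) (hmult : W.HasMultiplicativeReductionAt v) (hpos : 0 < W.Δ)
    (hIQ : IsImaginaryQuadratic K) (hodd : Odd (NumberField.discr K))
    (h3 : NumberField.discr K ≠ -3) (hHe : SatisfiesHeegnerHypothesis (W.conductorNorm ℤ) K)
    (hsq1 : ¬ IsSquare ((NumberField.discr K : ℚ) * -|W.Δ|)) (hsq2 : ¬ IsSquare ((NumberField.discr K : ℚ) * (-(2 * |W.Δ|))))
    (hρ : ∀ n : ℕ, 0 < n → W.HasSurjectiveModNGaloisRep ((2 : ℤ) ^ n))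
    (Dt : ModularParametrizationData W (W.conductorNorm ℤ)) (β : ℤ) (ι : K →+* ℂ) (d₁ : KolyvaginHeegnerData Dt β ι 1)
    (hy : ¬ IsOfFinAddOrder d₁.derivedPoint) (M₀ : ℕ) (hM₀ : 1 ≤ M₀)
    (hdiv : ∃ Q : (W.baseChange (ringClassField K ι 1)).toAffine.Point, ((2 ^ M₀ : ℕ) : ℤ) • Q = d₁.derivedPoint)
    (hndiv : ¬ ∃ Q : (W.baseChange (ringClassField K ι 1)).toAffine.Point, ((2 ^ (M₀ + 1) : ℕ) : ℤ) • Q = d₁.derivedPoint)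
    (Wd : WeierstrassCurve ℚ) [Wd.IsElliptic] [Wd.IsGloballyMinimal] (Cd : VariableChange ℚ) (hCd : Cd • W.quadraticTwist (discr K : ℚ) = Wd)
    (hSel : Nat.card (Wd.selmerGroup 2) = 2) (hDEF : padicValNat 2 Wd.tamagawaProduct = 0)
    (h4 : Nat.card (W.selmerGroup 2) = 4 ∧ ∃ c ∈ (W.kummerSelmerStructure ((2 : ℕ) : ℤ)).selmerGroup,
      galoisCohomology.localization (W.torsionGaloisModule ((2 : ℕ) : ℤ)) (Sum.inl Rat.infinitePlace) 1 c ≠ 0)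
    (hr0 : W.analyticRank = 0) (h2K : ((Ideal.span {(2 : ℤ)}).primesOver (𝓞 K)).ncard = 2) {σ₀ : K ≃ₐ[ℚ] K} (hσ₀ : σ₀ ≠ 1) :
    (∃ (n : ℕ) (d : KolyvaginHeegnerData Dt β ι n), Squarefree n ∧
      (∀ ℓ ∈ n.primeFactors, Zhang2014.IsKolyvaginPrime (W.conductorNorm ℤ) W K 2 ℓ ∧ 2 ≤ Zhang2014.kolyvaginIndex W 2 ℓ ∧
        ∃ (v : HeightOneSpectrum (𝓞 ℚ)) (𝔓 : Ideal (absIntegers (𝓞 ℚ) ℚ)) (h : absoluteGaloisGroup ℚ),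
          ((ℓ : ℕ) : 𝓞 ℚ) ∈ v.asIdeal ∧ 𝔓 ∈ v.primesAbove ∧ IsArithFrobAt (𝓞 ℚ) h 𝔓 ∧ ∃ u : W.geomTorsion ((2 : ℕ) : ℤ), h • u ≠ u) ∧
      ¬ ∃ Q : (W.baseChange (ringClassField K ι n)).toAffine.Point, (2 : ℤ) • Q = d.derivedPoint) ↔
    Nat.card (W.selmerGroup ((2 ^ M₀ : ℕ) : ℤ)) ≠ Nat.card (W.selmerGroup ((2 ^ (M₀ - 1) : ℕ) : ℤ)) := by
  obtain ⟨e, he1, heM, hYe, hprof⟩ := exists_selmerProfile_of_kFourPos_cut W K hQ2 hcm hT v h2v hNv hmult hpos hIQ hodd h3 hHe hsq1 hsq2 hρ Dt β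
    ι d₁ hy M₀ hdiv hndiv Wd Cd hCd hSel hDEF h4 hr0 h2K hσ₀
  rw [kFourPos_witness_iff_natCard_selmerGroup_eq_pow_of_cut W K hQ2 hcm hT v h2v hNv hmult hpos hIQ hodd h3 hHe hsq1 hsq2 hρ Dt β ι d₁ hy M₀ hM₀
    hdiv hndiv Wd Cd hCd hSel hDEF h4 hr0 h2K hσ₀, hprof M₀, hprof (M₀ - 1)]
  constructor
  · intro h hne
    have hmin : min M₀ e = M₀ := Nat.pow_right_injective (by norm_num : 2 ≤ 4) h
    have hMe : e = M₀ := le_antisymm heM (by rw [← hmin]; exact min_le_right _ _)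
    have h' : min M₀ e = min (M₀ - 1) e := Nat.pow_right_injective (by norm_num : 2 ≤ 4) hne
    rw [hMe, min_self, min_eq_left (Nat.sub_le M₀ 1)] at h'
    omega
  · intro hne
    have hMe : M₀ ≤ e := by
      by_contra hlt
      apply hne
      rw [min_eq_right (by omega : e ≤ M₀), min_eq_right (by omega : e ≤ M₀ - 1)]
    rw [min_eq_left hMe]

/-- **DEPTH TWO, unconditional (mod Q2): on the K₄⁺ cut cell with `M₀ = 2`, `#Sel₄(E/ℚ) = 4` or `#Sel₄(E/ℚ) = 16`** (one block: `= 4^(min 2 e)`,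
`e ∈ {1, 2}`) — never `8`.  BSD is NOT proved by this. [cite: Cassels1962ArithmeticIV, §1] [cite: SilvermanAEC2009, Thm. X.4.2, X.4.14] -/
theorem natCard_selmerGroup_four_eq_four_or_sixteen_of_kFourPos_cut (hQ2 : KolyvaginRelationAtTwo) (hcm : ¬ W.HasCM)
    (hT : Odd W.tamagawaProduct) (v : HeightOneSpectrum (𝓞 ℚ)) (h2v : ((2 : ℕ) : 𝓞 ℚ) ∉ v.asIdeal)
    (hNv : ((W.conductorNorm ℤ : ℕ) : 𝓞 ℚ) ∈ v.asIdeal) (hmult : W.HasMultiplicativeReductionAt v) (hpos : 0 < W.Δ)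
    (hIQ : IsImaginaryQuadratic K) (hodd : Odd (NumberField.discr K))
    (h3 : NumberField.discr K ≠ -3) (hHe : SatisfiesHeegnerHypothesis (W.conductorNorm ℤ) K)
    (hsq1 : ¬ IsSquare ((NumberField.discr K : ℚ) * -|W.Δ|)) (hsq2 : ¬ IsSquare ((NumberField.discr K : ℚ) * (-(2 * |W.Δ|))))
    (hρ : ∀ n : ℕ, 0 < n → W.HasSurjectiveModNGaloisRep ((2 : ℤ) ^ n))
    (Dt : ModularParametrizationData W (W.conductorNorm ℤ)) (β : ℤ) (ι : K →+* ℂ) (d₁ : KolyvaginHeegnerData Dt β ι 1)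
    (hy : ¬ IsOfFinAddOrder d₁.derivedPoint)
    (hdiv : ∃ Q : (W.baseChange (ringClassField K ι 1)).toAffine.Point, ((2 ^ 2 : ℕ) : ℤ) • Q = d₁.derivedPoint)
    (hndiv : ¬ ∃ Q : (W.baseChange (ringClassField K ι 1)).toAffine.Point, ((2 ^ (2 + 1) : ℕ) : ℤ) • Q = d₁.derivedPoint)
    (Wd : WeierstrassCurve ℚ) [Wd.IsElliptic] (Cd : VariableChange ℚ) (hCd : Cd • W.quadraticTwist (discr K : ℚ) = Wd)
    (hSel : Nat.card (Wd.selmerGroup 2) = 2) (hDEF : padicValNat 2 Wd.tamagawaProduct = 0)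
    (h4 : Nat.card (W.selmerGroup 2) = 4 ∧ ∃ c ∈ (W.kummerSelmerStructure ((2 : ℕ) : ℤ)).selmerGroup,
      galoisCohomology.localization (W.torsionGaloisModule ((2 : ℕ) : ℤ)) (Sum.inl Rat.infinitePlace) 1 c ≠ 0)
    (hr0 : W.analyticRank = 0) (h2K : ((Ideal.span {(2 : ℤ)}).primesOver (𝓞 K)).ncard = 2) {σ₀ : K ≃ₐ[ℚ] K} (hσ₀ : σ₀ ≠ 1) :
    Nat.card (W.selmerGroup 4) = 4 ∨ Nat.card (W.selmerGroup 4) = 16 := by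
  obtain ⟨e, he1, heM, -, hprof⟩ := exists_selmerProfile_of_kFourPos_cut W K hQ2 hcm hT v h2v hNv hmult hpos hIQ hodd h3 hHe hsq1 hsq2 hρ Dt β ι
    d₁ hy 2 hdiv hndiv Wd Cd hCd hSel hDEF h4 hr0 h2K hσ₀
  have h := hprof 2
  have e4 : ((2 ^ 2 : ℕ) : ℤ) = 4 := by norm_num
  rw [e4] at h
  rw [h]
  interval_cases e
  · left; norm_num
  · right; norm_num

/-- **DEPTH TWO: K4Pos witness ⟺ `#Sel₄(E/ℚ) = 16`** on the `M₀ = 2` K₄⁺ cut cell, mod Q2 ONLY — the single `4`-descent count that decides K₄⁺ at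
that curve (BSD predicts `16` there, `#Ш_an = 16`).  BSD / K4Pos are NOT proved by this. [cite: Kolyvagin1989Izv, Thm. B₂] [cite: McCallumLMS1991, §5 Thm. 5.4] -/
theorem kFourPos_witness_iff_natCard_selmerGroup_four_eq_sixteen_of_cut (hQ2 : KolyvaginRelationAtTwo) (hcm : ¬ W.HasCM)
    (hT : Odd W.tamagawaProduct) (v : HeightOneSpectrum (𝓞 ℚ)) (h2v : ((2 : ℕ) : 𝓞 ℚ) ∉ v.asIdeal)
    (hNv : ((W.conductorNorm ℤ : ℕ) : 𝓞 ℚ) ∈ v.asIdeal) (hmult : W.HasMultiplicativeReductionAt v) (hpos : 0 < W.Δ)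
    (hIQ : IsImaginaryQuadratic K) (hodd : Odd (NumberField.discr K))
    (h3 : NumberField.discr K ≠ -3) (hHe : SatisfiesHeegnerHypothesis (W.conductorNorm ℤ) K)
    (hsq1 : ¬ IsSquare ((NumberField.discr K : ℚ) * -|W.Δ|)) (hsq2 : ¬ IsSquare ((NumberField.discr K : ℚ) * (-(2 * |W.Δ|))))
    (hρ : ∀ n : ℕ, 0 < n → W.HasSurjectiveModNGaloisRep ((2 : ℤ) ^ n))
    (Dt : ModularParametrizationData W (W.conductorNorm ℤ)) (β : ℤ) (ι : K →+* ℂ) (d₁ : KolyvaginHeegnerData Dt β ι 1)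
    (hy : ¬ IsOfFinAddOrder d₁.derivedPoint)
    (hdiv : ∃ Q : (W.baseChange (ringClassField K ι 1)).toAffine.Point, ((2 ^ 2 : ℕ) : ℤ) • Q = d₁.derivedPoint)
    (hndiv : ¬ ∃ Q : (W.baseChange (ringClassField K ι 1)).toAffine.Point, ((2 ^ (2 + 1) : ℕ) : ℤ) • Q = d₁.derivedPoint)
    (Wd : WeierstrassCurve ℚ) [Wd.IsElliptic] [Wd.IsGloballyMinimal] (Cd : VariableChange ℚ) (hCd : Cd • W.quadraticTwist (discr K : ℚ) = Wd)
    (hSel : Nat.card (Wd.selmerGroup 2) = 2) (hDEF : padicValNat 2 Wd.tamagawaProduct = 0)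
    (h4 : Nat.card (W.selmerGroup 2) = 4 ∧ ∃ c ∈ (W.kummerSelmerStructure ((2 : ℕ) : ℤ)).selmerGroup,
      galoisCohomology.localization (W.torsionGaloisModule ((2 : ℕ) : ℤ)) (Sum.inl Rat.infinitePlace) 1 c ≠ 0)
    (hr0 : W.analyticRank = 0) (h2K : ((Ideal.span {(2 : ℤ)}).primesOver (𝓞 K)).ncard = 2) {σ₀ : K ≃ₐ[ℚ] K} (hσ₀ : σ₀ ≠ 1) :
    (∃ (n : ℕ) (d : KolyvaginHeegnerData Dt β ι n), Squarefree n ∧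
      (∀ ℓ ∈ n.primeFactors, Zhang2014.IsKolyvaginPrime (W.conductorNorm ℤ) W K 2 ℓ ∧ 2 ≤ Zhang2014.kolyvaginIndex W 2 ℓ ∧
        ∃ (v : HeightOneSpectrum (𝓞 ℚ)) (𝔓 : Ideal (absIntegers (𝓞 ℚ) ℚ)) (h : absoluteGaloisGroup ℚ),
          ((ℓ : ℕ) : 𝓞 ℚ) ∈ v.asIdeal ∧ 𝔓 ∈ v.primesAbove ∧ IsArithFrobAt (𝓞 ℚ) h 𝔓 ∧ ∃ u : W.geomTorsion ((2 : ℕ) : ℤ), h • u ≠ u) ∧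
      ¬ ∃ Q : (W.baseChange (ringClassField K ι n)).toAffine.Point, (2 : ℤ) • Q = d.derivedPoint) ↔
    Nat.card (W.selmerGroup 4) = 16 := by
  have h := kFourPos_witness_iff_natCard_selmerGroup_eq_pow_of_cut W K hQ2 hcm hT v h2v hNv hmult hpos hIQ hodd h3 hHe hsq1 hsq2 hρ Dt β ι d₁ hy
    2 (by norm_num) hdiv hndiv Wd Cd hCd hSel hDEF h4 hr0 h2K hσ₀
  have e4 : ((2 ^ 2 : ℕ) : ℤ) = 4 := by norm_num
  have e16 : (4 : ℕ) ^ 2 = 16 := by norm_num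
  rw [e4, e16] at h
  exact h

end KFourPos

/-! ## §4 The K₄ cut cell (Δ < 0): the same Selmer profile -/

section KFourNeg

variable (W : WeierstrassCurve ℚ) [W.IsElliptic] [W.IsGloballyMinimal] [NeZero (W.conductorNorm ℤ)]
variable (K : Type) [Field K] [NumberField K]

/-- **THE SELMER PROFILE OF THE K₄ CUT CELL (Δ < 0), mod Q2 (no GZK, no witness)**, on gk2-p4 g29's K₄ cut frame VERBATIM
(`exists_addEquiv_shaPrimary_of_kFourNeg_cut`): ONE `e` with `1 ≤ e ≤ M₀`, `#Ш(E/ℚ)[2^∞] = 4^e`, and **`#Sel_(2^k)(E/ℚ) = 4^(min k e)` for EVERY `k`**.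
K4Neg at `E` ⟺ `e = M₀` (LEAD p773559 / this seat's `kFourNeg_conclusion_iff_natCard_selmerGroup_eq_pow`).  BSD is NOT proved by this.
[cite: Kolyvagin1989Izv, Thm. B₂] [cite: SilvermanAEC2009, Thm. X.4.2, X.4.14] [cite: Cassels1962ArithmeticIV, §1] [cite: McCallumLMS1991, §5 Cor. 5.6] -/
theorem exists_selmerProfile_of_kFourNeg_cut (hQ2 : KolyvaginRelationAtTwo) (hcm : ¬ W.HasCM)
    (hT : Odd W.tamagawaProduct) (v : HeightOneSpectrum (𝓞 ℚ)) (h2v : ((2 : ℕ) : 𝓞 ℚ) ∉ v.asIdeal)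
    (hNv : ((W.conductorNorm ℤ : ℕ) : 𝓞 ℚ) ∈ v.asIdeal) (hmult : W.HasMultiplicativeReductionAt v) (hΔ : W.Δ < 0)
    (hIQ : IsImaginaryQuadratic K) (hodd : Odd (NumberField.discr K))
    (h3 : NumberField.discr K ≠ -3) (hHe : SatisfiesHeegnerHypothesis (W.conductorNorm ℤ) K)
    (hsq1 : ¬ IsSquare ((NumberField.discr K : ℚ) * -|W.Δ|)) (hsq2 : ¬ IsSquare ((NumberField.discr K : ℚ) * (-(2 * |W.Δ|))))
    (hρ : ∀ n : ℕ, 0 < n → W.HasSurjectiveModNGaloisRep ((2 : ℤ) ^ n))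
    (Dt : ModularParametrizationData W (W.conductorNorm ℤ)) (β : ℤ) (ι : K →+* ℂ) (d₁ : KolyvaginHeegnerData Dt β ι 1)
    (hy : ¬ IsOfFinAddOrder d₁.derivedPoint) (M₀ : ℕ)
    (hdiv : ∃ Q : (W.baseChange (ringClassField K ι 1)).toAffine.Point, ((2 ^ M₀ : ℕ) : ℤ) • Q = d₁.derivedPoint)
    (hndiv : ¬ ∃ Q : (W.baseChange (ringClassField K ι 1)).toAffine.Point, ((2 ^ (M₀ + 1) : ℕ) : ℤ) • Q = d₁.derivedPoint)
    (Wd : WeierstrassCurve ℚ) [Wd.IsElliptic] (hWd : ∃ C : VariableChange ℚ, C • W.quadraticTwist (discr K : ℚ) = Wd)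
    (hSel : Nat.card (Wd.selmerGroup 2) = 2) (hDEF : padicValNat 2 Wd.tamagawaProduct ≤ 1)
    (h4 : Nat.card (W.selmerGroup 2) = 4) (hr0 : W.analyticRank = 0)
    (h2K : ((Ideal.span {(2 : ℤ)}).primesOver (𝓞 K)).ncard = 2) {ℓ₀ : ℕ} [Fact ℓ₀.Prime] (hd : discr K = -(ℓ₀ : ℤ))
    {σ₀ : K ≃ₐ[ℚ] K} (hσ₀ : σ₀ ≠ 1) :
    ∃ e : ℕ, 1 ≤ e ∧ e ≤ M₀ ∧ Nat.card (AddCommGroup.primaryComponent (↥W.sha) 2) = 4 ^ e ∧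
      ∀ k : ℕ, Nat.card (W.selmerGroup ((2 ^ k : ℕ) : ℤ)) = 4 ^ min k e := by
  have hw : W.rootNumber = 1 :=
    (Literature.Barriers.BirchSwinnertonDyer.even_analyticRank_iff_of_isNewformOf_conductorLevel Dt.isNewformOf).mp
      (by rw [hr0]; exact Even.zero)
  have hs2 : W.HasSurjectiveModNGaloisRep 2 := by simpa using hρ 1 one_pos
  obtain ⟨hrk0, -⟩ := mordellWeilRank_eq_zero_and_finite_shaPrimary_rat_of_cut W K hQ2 hcm hT v h2v hNv hmult hIQ hodd h3 hHe hsq1 hsq2 hρ Dt β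
    ι d₁ M₀ hndiv hw
  have h2t := forall_eq_zero_of_two_zsmul_eq_zero_of_natCard_torsionBy_two_eq_one W
    (by convert natCard_torsionBy_point_two_eq_one_of_hasSurjectiveModNGaloisRep_two W hs2)
  obtain ⟨e, he1, heM, -, ⟨eY⟩, -, hYe⟩ := exists_addEquiv_shaPrimary_of_kFourNeg_cut W K hQ2 hcm hT v h2v hNv hmult hΔ hIQ hodd h3 hHe hsq1
    hsq2 hρ Dt β ι d₁ hy M₀ hdiv hndiv Wd hWd hSel hDEF h4 hr0 h2K hd hσ₀
  exact ⟨e, he1, heM, hYe, fun k ↦ natCard_selmerGroup_two_pow_eq_pow_min_of_addEquiv W hrk0 h2t eY k⟩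

end KFourNeg

end Summit.BirchSwinnertonDyer.BirchSwinnertonDyer.Theorems.GenusExact.PlusDescent

end
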